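import Mathlib.CategoryTheory.Localization.CalculusOfFractions
import Mathlib.Algebra.Group.PUnit
import Literature.AlgebraicGeometry.Frobenioids.DivisorMonoidExamplesProofs
import HarnessLib

/-!
# Frobenioids I, §4: the birationalization of the Frobenioid of Example 4.3 EXISTS as a datum
# satisfying Prop. 4.4 (i)–(iii) — non-vacuity of the Remark 4.9.1 discharge

Mochizuki, *The geometry of Frobenioids I: the general theory*, Kyushu J. Math. **62** (2008)
293–400, kurims text pp. 82–83 (Prop. 4.4), p. 82 (Ex. 4.3), p. 90 (Rem. 4.9.1)
[cite: MochizukiFrdI2008, Prop. 4.4 p.82, Rem. 4.9.1 p.90]. Proof-only companion (theorems only) of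
`DivisorMonoidExamples.lean` (seat abc-iut-L1-t3) and `DivisorMonoidExamplesProofs.lean`; abc-iut node
`FrdI:Rmk4.9.1` (satisfiability of the binding used there).

`Ex43.remark491_of_isLocalization` discharges Rem. 4.9.1 for every birationalization datum
`B : data.BiratData` whose functor `C → C^birat` is a localisation at the co-angular pre-steps and which
satisfies the typed Prop. 4.4 (iii). Since t3's `BiratData` is a data-only INTERFACE and the cell's
construction of THE birationalization (seats abc-iut-L6-t8/L6-t6, `biratData hF hsq`) is stated for
pre-Frobenioid FUNCTORS `C ⥤ F_Φ` rather than for the raw operations `Ex43.data`, this file records that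
the binding is INHABITED for Ex. 4.3: `Ex43.exists_biratData` exhibits (inside the proof, no new
definitions) the datum "`C^birat :=` the localisation `C[W⁻¹]` of `C` at its co-angular pre-steps `W`
(Mathlib's `W.Localization`, `W.Q`), with the Frobenioid structure over the zero monoid `0_D` whose
Frobenius degree is the extension of `deg_Fr` to `C[W⁻¹]` (the degree functor `C → B(N_{≥1})` inverts
`W`), `Φ^birat := 0` and trivial divisor maps" and PROVES for it: `C → C^birat` is a localisation at `W`,
Prop. 4.4 (i) (`Prop44i`: over `D`, degrees preserved), Prop. 4.4 (ii) (`Prop44ii`: group-like type,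
faithful, `O^▷(A)` — trivial in Ex. 4.3 — goes to units) and Prop. 4.4 (iii) (`Prop44iii`: the exact
sequence `1 → O^×(A) → O^×(A^birat) → Φ^birat(A) → 1`, all three groups being trivial here by
`Ex43.aut_eq_one`). Consequently `Ex43.remark491_holds_at_birationalization`: Rem. 4.9.1 holds at an
actual birationalization datum, for every support predicate. The dictionary Prop. 4.4 (iv) is not
needed for Rem. 4.9.1 and is not treated. No statement of the paper is strengthened; nothing here
bears on [IUTchIII] Cor. 3.12.
-/

namespace Literature.AlgebraicGeometry.Frobenioids

open CategoryTheory

namespace Ex43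

/-- In `C` (Ex. 4.3) an arrow inverted by a localisation at the co-angular pre-steps not only has
degree `1` but more generally: the extension `G` of the degree functor to the localisation computes
`deg_Fr` — `G(L(f)) = deg_Fr(f)` — for the canonical factorisation data `(G, e)` (Prop. 4.4 (i):
"preserves Frobenius degrees"). Auxiliary form over an arbitrary localisation functor.
[cite: MochizukiFrdI2008, Prop. 4.4 (i) p.83] -/
theorem lift_map_eq_deg {E : Type*} [Category E] (L : Obj ⥤ E)
    [L.IsLocalization data.IsCoAngularPreStep] (degF : Obj ⥤ SingleObj ℕ+)
    (hdegF : ∀ {X Y : Obj} (f : X ⟶ Y), degF.map f = (Hom.deg f : ℕ+))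
    (G : E ⥤ SingleObj ℕ+) (e : L ⋙ G ≅ degF) {X Y : Obj} (f : X ⟶ Y) :
    G.map (L.map f) = (Hom.deg f : ℕ+) := by
  -- `e.hom.app X ≫ degF.map f ≫ e.inv.app Y = G.map (L.map f)`, read in `ℕ` through `N_{≥1} ⊆ ℕ`
  have h := NatIso.naturality_2 e f
  rw [SingleObj.comp_as_mul, SingleObj.comp_as_mul, singleObj_pnat_eq_one_of_isIso (e.hom.app X),
    singleObj_pnat_eq_one_of_isIso (e.inv.app Y), hdegF, CategoryTheory.Functor.comp_map] at h
  have h' := congrArg PNat.val h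
  rw [PNat.mul_coe, PNat.mul_coe, PNat.one_coe, one_mul, mul_one] at h'
  exact PNat.coe_injective h'.symm

/-- **The birationalization of the Frobenioid of Example 4.3 exists as a `BiratData` satisfying
Prop. 4.4 (i)–(iii)** (PROVED, witness built in the proof): `C^birat := C[W⁻¹]`, the localisation of
`C` at its co-angular pre-steps `W` (print: `Hom_{C^birat}(A, B) := lim Hom_C(A', B)` over the
co-angular pre-steps `A' → A`, p. 82; `W` has a right calculus of fractions), with the structure
`C^birat → F_{0_D}` of Prop. 4.4 (ii) (zero divisors, Frobenius degree extended from `C`),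
`Φ^birat := 0`, divisor maps trivial; for it `C → C^birat` is a localisation at `W` and the typed
`Prop44i`, `Prop44ii`, `Prop44iii` hold (`O^▷`, `O^×(A)`, `O^×(A^birat)` and `Φ^birat` all being trivial
for this `C`, pp. 82, 90). [cite: MochizukiFrdI2008, Prop. 4.4 p.82] -/
theorem exists_biratData :
    ∃ B : PreFrobenioidData.BiratData.{0, 0, 0, 0, 0, 0} data,
      B.toBirat.IsLocalization data.IsCoAngularPreStep ∧ PreFrobenioidData.Prop44i B ∧
        PreFrobenioidData.Prop44ii B ∧ PreFrobenioidData.Prop44iii B := by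
  haveI := hasRightCalculusOfFractions
  -- the degree functor `C → B(N_{≥1})` inverts the co-angular pre-steps and extends to `C[W⁻¹]`
  let degF : Obj ⥤ SingleObj ℕ+ :=
    { obj := fun _ => SingleObj.star ℕ+
      map := fun φ => Hom.deg φ
      map_id := fun _ => rfl
      map_comp := fun f g => by rw [SingleObj.comp_as_mul, comp_deg, mul_comm] }
  have hdeg : data.IsCoAngularPreStep.IsInvertedBy degF := fun X Y φ hφ => by
    have : degF.map φ = 𝟙 _ := by
      rw [SingleObj.id_as_one]; exact (isCoAngularPreStep_iff φ).mp hφ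
    rw [this]; infer_instance
  let G : data.IsCoAngularPreStep.Localization ⥤ SingleObj ℕ+ :=
    Localization.lift degF hdeg data.IsCoAngularPreStep.Q
  let e : data.IsCoAngularPreStep.Q ⋙ G ≅ degF := Localization.fac degF hdeg data.IsCoAngularPreStep.Q
  have hGQ : ∀ {X Y : Obj} (f : X ⟶ Y), G.map (data.IsCoAngularPreStep.Q.map f) = (Hom.deg f : ℕ+) :=
    fun f => lift_map_eq_deg data.IsCoAngularPreStep.Q degF (fun _ => rfl) G e f
  -- the Frobenioid structure `C^birat → F_{0_D}` as operations over `D`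
  let ops : PreFrobenioidData.{0} data.IsCoAngularPreStep.Localization D :=
    { base := (Functor.const _).obj (SingleObj.star PUnit.{1})
      Mon := fun _ => PUnit.{1}
      pull := fun _ => MonoidHom.id _
      pull_id := fun _ _ => rfl
      pull_comp := fun _ _ _ => rfl
      div := fun _ => PUnit.unit
      degFr := fun φ => G.map φ
      div_id := fun _ => rfl
      div_comp := fun _ _ => rfl
      degFr_id := fun A => G.map_id A
      degFr_comp := fun ψ φ => by rw [G.map_comp, SingleObj.comp_as_mul, mul_comm] }
  let B : PreFrobenioidData.BiratData.{0, 0, 0, 0, 0, 0} data :=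
    { Birat := data.IsCoAngularPreStep.Localization
      toBirat := data.IsCoAngularPreStep.Q
      obj_surjective := (Localization.Construction.objEquiv data.IsCoAngularPreStep).surjective
      ops := ops
      ops_mon_eq_one := fun _ _ => rfl
      overBase := NatIso.ofComponents (fun _ => Iso.refl _) (fun _ => rfl)
      phiBirat := fun _ => ⊥
      divBirat := fun _ => 1
      divBirat_mem := fun _ _ => by rw [MonoidHom.one_apply]; exact Subgroup.one_mem _ }
  refine ⟨B, (inferInstance : data.IsCoAngularPreStep.Q.IsLocalization data.IsCoAngularPreStep),
    ?_, ?_, ?_⟩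
  · -- Prop. 4.4 (i): over `D` and degree-preserving
    exact ⟨⟨B.overBase⟩, fun _ _ φ => hGQ φ⟩
  · -- Prop. 4.4 (ii): group-like type; faithful; `O^▷(A) = {id}` goes to units
    refine ⟨⟨fun _ _ => rfl⟩, ⟨fun {X Y} f g h => ?_⟩, ?_⟩
    · obtain ⟨Z, s, hs, hfac⟩ :=
        (MorphismProperty.map_eq_iff_precomp data.IsCoAngularPreStep.Q data.IsCoAngularPreStep f g).mp h
      have hdeg' := congrArg Hom.deg hfac
      rw [comp_deg, comp_deg, (isCoAngularPreStep_iff s).mp hs, one_mul, one_mul] at hdeg'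
      exact hom_ext hdeg'
    · intro A α hα
      rw [endSubmonoid_eq_bot, Submonoid.mem_bot] at hα
      subst hα
      refine ⟨?_, ?_, ?_⟩
      · show IsIso (data.IsCoAngularPreStep.Q.map (𝟙 A))
        rw [CategoryTheory.Functor.map_id]; infer_instance
      · show ops.base.map (data.IsCoAngularPreStep.Q.map (𝟙 A)) = 𝟙 _
        rfl
      · show G.map (data.IsCoAngularPreStep.Q.map (𝟙 A)) = (1 : ℕ+)
        rw [hGQ]; rfl
  · -- Prop. 4.4 (iii): `Φ^birat = 0 = Im(O^×(A^birat))`, `O^×(A^birat) = {1} = Im(O^×(A))`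
    intro A
    refine ⟨fun y hy => ⟨1, ?_⟩, fun u => ⟨fun _ => ⟨1, Subgroup.one_mem _, ?_⟩, fun _ => ?_⟩⟩
    · rw [Subgroup.mem_bot] at hy
      rw [hy, map_one]
    · have hu : (u : Aut (data.IsCoAngularPreStep.Q.obj A)) = 1 :=
        aut_eq_one data.IsCoAngularPreStep.Q A u
      rw [hu]
      exact Functor.mapIso_refl _ _
    · exact MonoidHom.one_apply _

/-- **Remark 4.9.1 at an actual birationalization** (non-vacuity of the discharge
`remark491_of_isLocalization`): there is a birationalization datum `B` of the Frobenioid of Ex. 4.3 —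
`C → C^birat` a localisation at the co-angular pre-steps, Prop. 4.4 (i)–(iii) holding — and for it
(indeed for every such `B`) the Frobenioid of Ex. 4.3 is not of rational type, whatever the support
predicate (FrdI p. 90). [cite: MochizukiFrdI2008, Rem. 4.9.1 p.90] -/
theorem remark491_holds_at_birationalization :
    ∃ B : PreFrobenioidData.BiratData.{0, 0, 0, 0, 0, 0} data,
      B.toBirat.IsLocalization data.IsCoAngularPreStep ∧ PreFrobenioidData.Prop44i B ∧
        PreFrobenioidData.Prop44ii B ∧ PreFrobenioidData.Prop44iii B ∧
        ∀ Supp : ∀ {X : D}, data.Mon X → Primes (data.Mon X) → Prop, Remark491 B Supp := by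
  obtain ⟨B, hL, h1, h2, h3⟩ := exists_biratData
  haveI := hL
  exact ⟨B, hL, h1, h2, h3, fun Supp => remark491_of_isLocalization B h3 Supp⟩

end Ex43

end Literature.AlgebraicGeometry.Frobenioids
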